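import Summits.QuantumFields.YangMills.Theorems.ConvexGribovBodyCovarianceBoundStubLieAlgPerfect
import Literature.MathematicalPhysics.QuantumLattice.RepLieAlgebra
import Literature.Analysis.Calculus.ClosedSubgroupExpChart
import Mathlib.Analysis.Normed.Algebra.MatrixExponential
import Mathlib.Analysis.SpecialFunctions.Exponential

/-!
# Stub `stub_lieSimple` of the line `SketchIdeator1` for the crux `BrascampLiebVacuumSC`
# (stmt-QuantumFields-16404, route `ConvexGribovBody`)

For a compact simple `G` (`IsSimpleCompactGroup`: connected, non-abelian, every closed connected
normal subgroup is `⊥` or `⊤`) with a faithful unitary `r : LatticeRep G`, the matrix Lie algebra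
`𝔥 = repLieAlgebra r ⊆ 𝔲(N)` is a simple real Lie algebra: every real subspace `I ≤ 𝔥` with
`[𝔥, I] ⊆ I` is `⊥` or `𝔥` (Sepanski, Thm. 5.18; Bröcker–tom Dieck V (7.11)–(7.13)).

Proof (classification-free). `J := 𝔥 ∩ I^⊥` for the `ad`-invariant Hilbert–Schmidt form
`Re tr(X Yᴴ)` (tree `hsForm`, `LiePerfect.hsForm_bracket_left`) is an ideal with `[I, J] = 0` and
`𝔥 = I + J`. Ideals are `Ad ρ(G)`-stable (`LieSimple.conj_mem_of_ideal`):
`e^{X} Z e^{−X} = exp(ad_X) Z` (Hall, Prop. 3.35, proved here in the Banach algebra of real-linear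
operators on `M_N(ℂ)`: `ad_X = L_X − R_X` with commuting summands, `exp ∘ L = L ∘ exp`), `exp 𝔥`
fills a neighbourhood of `1` in `ρ(G)` (tree `exists_exp_chart_range`), and an open subgroup of the
connected `G` is `G`.
Hence the centraliser `K` of `J` in `G` is a closed normal subgroup and its identity component `K°`
(`LieSimple.exists_identityComponent`) is closed, connected and normal, so `K° = ⊤` — then `J`
commutes with `ρ(G)`, hence with `𝔥`, hence `J = 0` (`LiePerfect.eq_zero_of_commute_lieAlg`) and
`I = 𝔥` — or `K° = ⊥` — then every one-parameter subgroup `ρ⁻¹(e^{ℝY}) ⊆ K`, `Y ∈ I`, is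
trivial, so `I = 0`.
No named facts are used.
-/

set_option autoImplicit false

open scoped Topology Matrix
open Filter Set NormedSpace
open Literature.MathematicalPhysics.QuantumFieldTheory
open Literature.MathematicalPhysics.QuantumLattice

noncomputable section

namespace Summit.QuantumFields.YangMills.Theorems.BrascampLiebVacuumSC

namespace LieSimple

section Matrices

variable {N : ℕ}

/-- Every element of a real normed algebra lies in the ball of convergence of the exponential
series (its radius is `∞`). [folklore] -/
theorem mem_eball_expSeries {A : Type*} [NormedRing A] [NormedAlgebra ℝ A] (a : A) :
    a ∈ Metric.eball (0 : A) (expSeries ℝ A).radius :=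
  (expSeries_radius_eq_top ℝ A).symm ▸ edist_lt_top _ _

set_option backward.isDefEq.respectTransparency false in
open scoped Matrix.Norms.Operator in
/-- **`ad`-stable subspaces are `Ad ∘ exp`-stable.** If a real subspace `J` of `M_N(ℂ)` is
stable under `ad_X = [X, ·]` then `e^{X} Z e^{−X} ∈ J` for `Z ∈ J`: in the Banach algebra of bounded
real-linear operators on `M_N(ℂ)`, `ad_X = L_X − R_X` with commuting left and right
multiplications, so `exp(ad_X) = exp(L_X) exp(−R_X) = L_{e^X} R_{e^{−X}}` (continuous ring
homomorphisms commute with `exp`), while `exp(ad_X) Z = Σₙ adⁿ_X Z / n!` lies in the closed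
subspace `J`. [cite: Hall2015, Proposition 3.35] -/
theorem exp_mul_mul_exp_neg_mem (J : Submodule ℝ (Matrix (Fin N) (Fin N) ℂ))
    {X : Matrix (Fin N) (Fin N) ℂ} (hX : ∀ Z ∈ J, X * Z - Z * X ∈ J)
    {Z : Matrix (Fin N) (Fin N) ℂ} (hZ : Z ∈ J) : exp X * Z * exp (-X) ∈ J := by
  -- left and right multiplications as continuous ring homomorphisms into the operator algebra
  let Lh : Matrix (Fin N) (Fin N) ℂ →+* (Matrix (Fin N) (Fin N) ℂ →L[ℝ] Matrix (Fin N) (Fin N) ℂ) :=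
    { toFun := fun Y => ContinuousLinearMap.mul ℝ (Matrix (Fin N) (Fin N) ℂ) Y
      map_one' := by ext1 W; simp
      map_mul' := fun Y Y' => by ext1 W; simp [mul_assoc]
      map_zero' := by simp
      map_add' := fun Y Y' => by simp }
  let Rh : (Matrix (Fin N) (Fin N) ℂ)ᵐᵒᵖ →+*
      (Matrix (Fin N) (Fin N) ℂ →L[ℝ] Matrix (Fin N) (Fin N) ℂ) :=
    { toFun := fun Y => (ContinuousLinearMap.mul ℝ (Matrix (Fin N) (Fin N) ℂ)).flip Y.unop
      map_one' := by ext1 W; simp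
      map_mul' := fun Y Y' => by ext1 W; simp [mul_assoc]
      map_zero' := by simp
      map_add' := fun Y Y' => by simp }
  have hLc : Continuous Lh := (ContinuousLinearMap.mul ℝ (Matrix (Fin N) (Fin N) ℂ)).continuous
  have hRc : Continuous Rh :=
    (ContinuousLinearMap.mul ℝ (Matrix (Fin N) (Fin N) ℂ)).flip.continuous.comp
      MulOpposite.continuous_unop
  have hL : exp (Lh X) = Lh (exp X) :=
    (map_exp_of_mem_ball (𝕂 := ℝ) Lh hLc X (mem_eball_expSeries X)).symm
  have hR : exp (Rh (MulOpposite.op (-X))) = Rh (MulOpposite.op (exp (-X))) := by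
    rw [← exp_op]
    exact (map_exp_of_mem_ball (𝕂 := ℝ) Rh hRc _ (mem_eball_expSeries _)).symm
  have hcomm : Commute (Lh X) (Rh (MulOpposite.op (-X))) := by
    refine ContinuousLinearMap.ext fun W => ?_
    show (Lh X * Rh _) W = (Rh _ * Lh X) W
    simp [Lh, Rh, mul_assoc]
  set T := Lh X + Rh (MulOpposite.op (-X)) with hT
  have hTapply : ∀ W, T W = X * W - W * X := fun W => by
    simp [T, Lh, Rh, sub_eq_add_neg]
  have hexpT : exp T = Lh (exp X) * Rh (MulOpposite.op (exp (-X))) := by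
    rw [hT, exp_add_of_commute_of_mem_ball hcomm (mem_eball_expSeries _) (mem_eball_expSeries _),
      hL, hR]
  -- powers of `T = ad_X` preserve `J`
  have hpow : ∀ n : ℕ, ∀ W ∈ J, (T ^ n) W ∈ J := by
    intro n
    induction n with
    | zero => intro W hW; simpa using hW
    | succ n ih =>
      intro W hW
      rw [pow_succ', mul_apply_eq_comp, hTapply]
      exact hX _ (ih W hW)
  -- the exponential series of `T`, evaluated at `Z`, converges inside the closed subspace `J`
  have hsum : HasSum (fun n : ℕ => ((n.factorial⁻¹ : ℝ) • T ^ n) Z) (exp T Z) :=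
    (exp_series_hasSum_exp' (𝕂 := ℝ) T).mapL
      (ContinuousLinearMap.apply ℝ (Matrix (Fin N) (Fin N) ℂ) Z)
  have hmem : exp T Z ∈ J := by
    refine (J.closed_of_finiteDimensional).mem_of_tendsto hsum.tendsto_sum_nat
      (Eventually.of_forall fun n => Submodule.sum_mem _ fun i _ => ?_)
    rw [smul_apply]
    exact J.smul_mem _ (hpow i Z hZ)
  rw [hexpT, mul_apply_eq_comp] at hmem
  simpa [Lh, Rh, mul_assoc] using hmem

set_option backward.isDefEq.respectTransparency false in
open scoped Matrix.Norms.Operator in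
/-- **Commuting with a one-parameter group is commuting with its generator**: if
`e^{tX} Z = Z e^{tX}` for all real `t` then `XZ = ZX` (differentiate at `t = 0`). [folklore] -/
theorem mul_comm_of_forall_exp_smul {X Z : Matrix (Fin N) (Fin N) ℂ}
    (h : ∀ t : ℝ, exp (t • X) * Z = Z * exp (t • X)) : X * Z = Z * X := by
  have hX : HasDerivAt (fun t : ℝ => exp (t • X)) X 0 := by
    simpa using hasDerivAt_exp_smul_const' (𝕂 := ℝ) X (0 : ℝ)
  have h1 : HasDerivAt (fun t : ℝ => exp (t • X) * Z) (X * Z) 0 := hX.mul_const Z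
  have h2 : HasDerivAt (fun t : ℝ => Z * exp (t • X)) (Z * X) 0 := hX.const_mul Z
  rw [show (fun t : ℝ => exp (t • X) * Z) = fun t => Z * exp (t • X) from funext h] at h1
  exact h1.unique h2

end Matrices

/-! ### Group-level helpers: `Ad`-stability of ideals, the identity component of a subgroup -/

section Group

variable {G : Type*} [Group G] [TopologicalSpace G]

/-- Membership in `repLieAlgebra r` with the REAL scalar action: `X ∈ 𝔥 ↔ e^{tX} ∈ ρ(G)` for all
real `t` (the tree's `mem_repLieAlgebra_iff`, whose right-hand side is written with `(t : ℂ) • X`,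
definitionally the same). [cite: Hall2015, Theorem 3.20] -/
theorem mem_repLieAlgebra_iff_real [CompactSpace G] (r : LatticeRep G)
    {X : Matrix (Fin r.N) (Fin r.N) ℂ} :
    X ∈ repLieAlgebra r ↔ ∀ t : ℝ, exp (t • X) ∈ Set.range r.ρ :=
  mem_matrixLieAlgebra_iff r.one_mem_range r.mul_mem_range r.isClosed_range

set_option backward.isDefEq.respectTransparency false in
open scoped Matrix.Norms.Frobenius in
/-- **A subgroup containing the exponential chart is everything** (`G` compact connected, `ρ`
faithful): if every `g` with `ρ(g) = e^X`, `X ∈ 𝔥`, lies in the subgroup `T`, then `T` contains the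
chart neighbourhood of `1` (von Neumann: every `ρ(g)` near `1` is such an exponential), so `T` is
open, hence closed, hence all of the connected `G`. [cite: vonNeumann1929, §3] -/
theorem subgroup_eq_top_of_exp [CompactSpace G] [IsTopologicalGroup G] [ConnectedSpace G]
    (r : LatticeRep G) (T : Subgroup G)
    (hT : ∀ (g : G) (X : Matrix (Fin r.N) (Fin r.N) ℂ), X ∈ repLieAlgebra r → exp X = r.ρ g →
      g ∈ T) : T = ⊤ := by
  obtain ⟨ε, hε, hchart⟩ := Literature.Analysis.Calculus.exists_exp_chart_range r.ρ r.continuous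
  have hnhds : (T : Set G) ∈ 𝓝 (1 : G) := by
    have hfc : Continuous fun A : Matrix (Fin r.N) (Fin r.N) ℂ => frobNorm A := by
      unfold frobNorm; fun_prop
    have hopen : IsOpen {a : G | frobNorm (r.ρ a - 1) < ε} :=
      isOpen_lt (hfc.comp (r.continuous.sub continuous_const)) continuous_const
    refine Filter.mem_of_superset (hopen.mem_nhds ?_) fun a ha => ?_
    · show frobNorm (r.ρ 1 - 1) < ε
      simpa [frobNorm] using hε
    · obtain ⟨X, hX, hXg, -⟩ := hchart a (by rw [← frobNorm_eq_norm]; exact ha)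
      refine hT a X ((mem_repLieAlgebra_iff_real r).2 fun t => ?_) hXg
      obtain ⟨k, hk⟩ := hX t
      exact ⟨k, hk⟩
  have hopenT : IsOpen (T : Set G) := T.isOpen_of_mem_nhds hnhds
  exact Subgroup.coe_eq_univ.1
    (IsClopen.eq_univ ⟨T.isClosed_of_isOpen hopenT, hopenT⟩ ⟨1, T.one_mem⟩)

/-- **Ideals of `𝔥` are `Ad ρ(G)`-stable** (`G` compact connected): if the real subspace `J` is
stable under `[X, ·]` for every `X ∈ 𝔥 = repLieAlgebra r`, then `ρ(g) Z ρ(g)⁻¹ ∈ J` for all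
`g : G`, `Z ∈ J`. The `g` with `Ad ρ(g^{±1}) J ⊆ J` form a subgroup containing every `g` with
`ρ(g) = e^X`, `X ∈ 𝔥` (`e^{X} Z e^{−X} = exp(ad_X) Z`, `exp_mul_mul_exp_neg_mem`), hence all of `G`
(`subgroup_eq_top_of_exp`). [cite: Hall2015, Proposition 3.35 and Theorem 3.20] -/
theorem conj_mem_of_ideal [CompactSpace G] [IsTopologicalGroup G] [ConnectedSpace G]
    (r : LatticeRep G) (J : Submodule ℝ (Matrix (Fin r.N) (Fin r.N) ℂ))
    (hJ : ∀ X ∈ repLieAlgebra r, ∀ Z ∈ J, X * Z - Z * X ∈ J) (g : G)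
    {Z : Matrix (Fin r.N) (Fin r.N) ℂ} (hZ : Z ∈ J) : r.ρ g * Z * r.ρ g⁻¹ ∈ J := by
  let T : Subgroup G :=
    { carrier := {g | ∀ Z ∈ J, r.ρ g * Z * r.ρ g⁻¹ ∈ J ∧ r.ρ g⁻¹ * Z * r.ρ g ∈ J}
      one_mem' := fun Z hZ => by simpa using hZ
      mul_mem' := fun {a b} ha hb Z hZ => by
        refine ⟨?_, ?_⟩
        · have h := (ha _ (hb Z hZ).1).1
          simpa only [map_mul, mul_inv_rev, mul_assoc] using h
        · have h := (hb _ (ha Z hZ).2).2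
          simpa only [map_mul, mul_inv_rev, mul_assoc] using h
      inv_mem' := fun {a} ha Z hZ => by
        obtain ⟨h1, h2⟩ := ha Z hZ
        exact ⟨by simpa only [inv_inv] using h2, by simpa only [inv_inv] using h1⟩ }
  have hT : T = ⊤ := by
    refine subgroup_eq_top_of_exp r T fun g X hX hgX W hW => ?_
    have h1 : r.ρ g⁻¹ * exp X = 1 := by rw [hgX, ← map_mul, inv_mul_cancel, map_one]
    have hinv : r.ρ g⁻¹ = exp (-X) := by rw [Matrix.exp_neg, Matrix.inv_eq_left_inv h1]
    rw [← hgX, hinv]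
    refine ⟨exp_mul_mul_exp_neg_mem J (hJ X hX) hW, ?_⟩
    have h := exp_mul_mul_exp_neg_mem J (hJ (-X) (neg_mem hX)) hW
    simpa only [neg_neg] using h
  have hg : g ∈ T := by rw [hT]; trivial
  exact (hg Z hZ).1

/-- Continuous self-maps of `G` preserving a subset `K` and moving `1` inside the connected
component `C` of `1` in `K` map `C` into itself. [folklore] -/
theorem image_connectedComponentIn_subset {K : Set G} {f : G → G} (hf : Continuous f)
    (hK : Set.MapsTo f K K) (h1 : f 1 ∈ connectedComponentIn K 1) :
    f '' connectedComponentIn K 1 ⊆ connectedComponentIn K 1 := by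
  have h1K : (1 : G) ∈ K := connectedComponentIn_nonempty_iff.1 ⟨_, h1⟩
  refine Set.Subset.trans ?_ (connectedComponentIn_eq h1).ge
  exact (isPreconnected_connectedComponentIn.image f hf.continuousOn).subset_connectedComponentIn
    (Set.mem_image_of_mem f (mem_connectedComponentIn h1K))
    ((Set.image_mono (connectedComponentIn_subset _ _)).trans hK.image_subset)

/-- **The identity component `K°` of a closed normal subgroup `K`** of a topological group `G`
(the connected component of `1` in the subset `K`) is a closed, preconnected, normal subgroup of
`G` inside `K`, containing every preconnected subset of `K` through `1`. (Translations, inversion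
and conjugations are homeomorphisms of `G` preserving `K`, so they preserve the component; its
closure is preconnected and inside the closed `K`.) [folklore] -/
theorem exists_identityComponent [IsTopologicalGroup G] (K : Subgroup G) (hKn : K.Normal)
    (hKc : IsClosed (K : Set G)) :
    ∃ K₀ : Subgroup G, K₀.Normal ∧ IsClosed (K₀ : Set G) ∧ IsPreconnected (K₀ : Set G) ∧
      K₀ ≤ K ∧ ∀ s : Set G, IsPreconnected s → (1 : G) ∈ s → s ⊆ K → s ⊆ K₀ := by
  have h1 : (1 : G) ∈ connectedComponentIn (K : Set G) 1 := mem_connectedComponentIn K.one_mem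
  let K₀ : Subgroup G :=
    { carrier := connectedComponentIn (K : Set G) 1
      one_mem' := h1
      mul_mem' := fun {a b} ha hb => by
        have haK : a ∈ K := connectedComponentIn_subset _ _ ha
        refine image_connectedComponentIn_subset (continuous_const_mul a)
          (fun x hx => K.mul_mem haK hx) ?_ ⟨b, hb, rfl⟩
        simpa only [mul_one] using ha
      inv_mem' := fun {a} ha => by
        refine image_connectedComponentIn_subset continuous_inv (fun x hx => K.inv_mem hx) ?_
          ⟨a, ha, rfl⟩
        simpa only [inv_one] using h1 }
  have hcoe : (K₀ : Set G) = connectedComponentIn (K : Set G) 1 := rfl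
  refine ⟨K₀, ⟨fun n hn h => ?_⟩, ?_, hcoe ▸ isPreconnected_connectedComponentIn,
    fun _ hx => connectedComponentIn_subset _ _ hx,
    fun s hs h1s hsK => hcoe ▸ hs.subset_connectedComponentIn h1s hsK⟩
  · refine image_connectedComponentIn_subset (f := fun x => h * x * h⁻¹) (by fun_prop)
      (fun x hx => hKn.conj_mem x hx h) ?_ ⟨n, hn, rfl⟩
    simpa only [mul_one, mul_inv_cancel] using h1
  · rw [hcoe, ← closure_subset_iff_isClosed]
    exact isPreconnected_connectedComponentIn.closure.subset_connectedComponentIn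
      (subset_closure h1)
      ((closure_mono (connectedComponentIn_subset _ _)).trans hKc.closure_subset)

end Group

end LieSimple

/-! ### The stub -/

open Summit.QuantumFields.YangMills.Cruxes.CovarianceBound.SupportWindow.LiePerfect LieSimple in
/-- **Stub `stub_lieSimple` (LIE THEORY — `𝔥` is a simple real Lie algebra).** For a compact simple
`G` (`IsSimpleCompactGroup`: connected, non-abelian, no proper non-trivial closed connected normal
subgroup) and a faithful unitary `r`, every ideal `I` of the matrix Lie algebra
`𝔥 = repLieAlgebra r` (a real subspace with `[𝔥, I] ⊆ I`) is `⊥` or `𝔥`: `J := 𝔥 ∩ I^⊥`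
(Hilbert–Schmidt form, `ad`-invariant) is an ideal with `[I, J] = 0` and `𝔥 = I + J`; ideals are
`Ad ρ(G)`-stable (`conj_mem_of_ideal`); the centraliser `K` of `J` is a closed normal subgroup
whose identity component `K°` is closed connected normal, so `K° = ⊤` (then `J` is central in
`𝔥`, hence `0` by `LiePerfect.eq_zero_of_commute_lieAlg`, so `I = 𝔥`) or `K° = ⊥` (then each
connected one-parameter subgroup `ρ⁻¹ e^{ℝY} ⊆ K`, `Y ∈ I`, is `{1}`, so `I = 0`).
[cite: Sepanski2007, Thm. 5.18] [cite: BrockerTomDieck1985, V (7.11)–(7.13)] -/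
theorem stub_lieSimple :
    ∀ (G : Type) [Group G] [TopologicalSpace G] [IsTopologicalGroup G] [CompactSpace G],
      IsCompactSimpleLieGroup G → ∀ (r : LatticeRep G),
        (∀ I : Submodule ℝ (Matrix (Fin r.N) (Fin r.N) ℂ), I ≤ repLieAlgebra r →
          (∀ X ∈ repLieAlgebra r, ∀ Y ∈ I, X * Y - Y * X ∈ I) → I = ⊥ ∨ I = repLieAlgebra r) := by
  intro G _ _ _ _ hG r I hIL hI
  haveI : ConnectedSpace G := hG.1.1
  have hskew : ∀ X ∈ repLieAlgebra r, star X = -X := fun X hX =>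
    skewAdjoint.mem_iff.1 (repLieAlgebra_le_skewAdjoint r hX)
  -- Step 1: the orthogonal ideal `J = 𝔥 ∩ I^⊥`
  set J : Submodule ℝ (Matrix (Fin r.N) (Fin r.N) ℂ) := repLieAlgebra r ⊓ (hsForm r.N).orthogonal I
  have hJL : J ≤ repLieAlgebra r := inf_le_left
  have hJorth : ∀ Z ∈ J, ∀ Y ∈ I, hsForm r.N Y Z = 0 := fun Z hZ Y hY =>
    (LinearMap.BilinForm.mem_orthogonal_iff.1 hZ.2) Y hY
  have hmemJ : ∀ Z ∈ repLieAlgebra r, (∀ Y ∈ I, hsForm r.N Y Z = 0) → Z ∈ J := fun Z hZ h =>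
    ⟨hZ, LinearMap.BilinForm.mem_orthogonal_iff.2 h⟩
  have hJideal : ∀ X ∈ repLieAlgebra r, ∀ Z ∈ J, X * Z - Z * X ∈ J := by
    intro X hX Z hZ
    refine hmemJ _ (mul_sub_mul_mem_repLieAlgebra r hX (hJL hZ)) fun Y hY => ?_
    rw [← hsForm_bracket_left Y X Z (hskew X hX)]
    have hYX : Y * X - X * Y ∈ I := by
      have h := I.neg_mem (hI X hX Y hY)
      rwa [neg_sub] at h
    exact hJorth Z hZ _ hYX
  have hIJ : ∀ Y ∈ I, ∀ Z ∈ J, Y * Z = Z * Y := by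
    intro Y hY Z hZ
    have h1 : Y * Z - Z * Y ∈ J := hJideal Y (hIL hY) Z hZ
    have h2 : Y * Z - Z * Y ∈ I := by
      have h := I.neg_mem (hI Z (hJL hZ) Y hY)
      rwa [neg_sub] at h
    exact sub_eq_zero.1 (hsForm_self_eq_zero.1 (hJorth _ h1 _ h2))
  have hsplit : ∀ X ∈ repLieAlgebra r, ∃ Y ∈ I, X - Y ∈ J := by
    intro X hX
    have hc : IsCompl I ((hsForm r.N).orthogonal I) :=
      (hsForm r.N).isCompl_orthogonal_of_restrict_nondegenerate hsForm_isRefl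
        (hsForm_restrict_nondegenerate I)
    have hX' : X ∈ I ⊔ (hsForm r.N).orthogonal I := by rw [hc.sup_eq_top]; trivial
    obtain ⟨Y, hY, W, hW, hYW⟩ := Submodule.mem_sup.1 hX'
    refine ⟨Y, hY, sub_mem hX (hIL hY), ?_⟩
    rwa [show X - Y = W by rw [← hYW]; abel]
  -- Step 2: `J` is `Ad ρ(G)`-stable
  have hAd : ∀ g : G, ∀ Z ∈ J, r.ρ g * Z * r.ρ g⁻¹ ∈ J := fun g Z hZ =>
    conj_mem_of_ideal r J hJideal g hZ
  -- Step 3: the centraliser `K` of `J`, a closed normal subgroup, and its identity component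
  let K : Subgroup G :=
    { carrier := {g | ∀ Z ∈ J, r.ρ g * Z = Z * r.ρ g}
      one_mem' := fun Z _ => by simp
      mul_mem' := fun {a b} ha hb Z hZ => by
        show r.ρ (a * b) * Z = Z * r.ρ (a * b)
        rw [map_mul, mul_assoc, hb Z hZ, ← mul_assoc, ha Z hZ, mul_assoc]
      inv_mem' := fun {a} ha Z hZ => by
        show r.ρ a⁻¹ * Z = Z * r.ρ a⁻¹
        have h1 : r.ρ a⁻¹ * r.ρ a = 1 := by rw [← map_mul, inv_mul_cancel, map_one]
        have h2 : r.ρ a * r.ρ a⁻¹ = 1 := by rw [← map_mul, mul_inv_cancel, map_one]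
        calc r.ρ a⁻¹ * Z = r.ρ a⁻¹ * Z * (r.ρ a * r.ρ a⁻¹) := by rw [h2, mul_one]
          _ = r.ρ a⁻¹ * (r.ρ a * Z) * r.ρ a⁻¹ := by rw [ha Z hZ]; simp only [mul_assoc]
          _ = Z * r.ρ a⁻¹ := by rw [← mul_assoc, h1, one_mul] }
  have hKclosed : IsClosed (K : Set G) := by
    show IsClosed {g : G | ∀ Z ∈ J, r.ρ g * Z = Z * r.ρ g}
    simp only [Set.setOf_forall]
    exact isClosed_iInter fun Z => isClosed_iInter fun _ =>
      isClosed_eq (r.continuous.mul continuous_const) (continuous_const.mul r.continuous)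
  have hKnormal : K.Normal := by
    refine ⟨fun n hn h Z hZ => ?_⟩
    have hW : r.ρ h⁻¹ * Z * r.ρ h ∈ J := by simpa only [inv_inv] using hAd h⁻¹ Z hZ
    have hc : r.ρ n * (r.ρ h⁻¹ * Z * r.ρ h) = r.ρ h⁻¹ * Z * r.ρ h * r.ρ n := hn _ hW
    have e1 : r.ρ h * r.ρ h⁻¹ = 1 := by rw [← map_mul, mul_inv_cancel, map_one]
    show r.ρ (h * n * h⁻¹) * Z = Z * r.ρ (h * n * h⁻¹)
    calc r.ρ (h * n * h⁻¹) * Z = r.ρ h * (r.ρ n * (r.ρ h⁻¹ * Z * r.ρ h)) * r.ρ h⁻¹ := by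
          rw [map_mul, map_mul]; simp only [mul_assoc, e1, mul_one]
      _ = r.ρ h * (r.ρ h⁻¹ * Z * r.ρ h * r.ρ n) * r.ρ h⁻¹ := by rw [hc]
      _ = Z * r.ρ (h * n * h⁻¹) := by
          rw [map_mul, map_mul]; simp only [← mul_assoc, e1, one_mul]
  obtain ⟨K₀, hK₀n, hK₀c, hK₀p, hK₀le, hK₀max⟩ := exists_identityComponent K hKnormal hKclosed
  rcases hG.1.2.2 K₀ hK₀n hK₀c hK₀p with hbot | htop
  · -- Step 5: `K° = ⊥` — every one-parameter subgroup `ρ⁻¹ e^{ℝY}`, `Y ∈ I`, is trivial: `I = ⊥`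
    left
    refine (Submodule.eq_bot_iff _).2 fun Y hY => ?_
    have hYL : Y ∈ repLieAlgebra r := hIL hY
    set S : Set G := {g | ∃ t : ℝ, r.ρ g = exp (t • Y)}
    have hSK : S ⊆ K := by
      rintro g ⟨t, ht⟩ Z hZ
      rw [ht]
      exact (((show Commute Y Z from hIJ Y hY Z hZ).smul_left t).exp_left).eq
    have hSpre : IsPreconnected S := by
      have hemb : Topology.IsClosedEmbedding r.ρ := r.continuous.isClosedEmbedding r.injective
      have hSimg : r.ρ '' S = Set.range fun t : ℝ => exp (t • Y) := by
        ext M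
        constructor
        · rintro ⟨g, ⟨t, ht⟩, rfl⟩
          exact ⟨t, ht.symm⟩
        · rintro ⟨t, rfl⟩
          obtain ⟨k, hk⟩ := (mem_repLieAlgebra_iff_real r).1 hYL t
          exact ⟨k, ⟨t, hk⟩, hk⟩
      rw [← hemb.isInducing.isPreconnected_image, hSimg]
      exact isPreconnected_range (continuous_exp_smul Y)
    have h1S : (1 : G) ∈ S := ⟨0, by rw [map_one, zero_smul, exp_zero]⟩
    have hSbot : S ⊆ (K₀ : Set G) := hK₀max S hSpre h1S hSK
    rw [hbot] at hSbot
    refine eq_of_forall_exp_smul_eq fun t => ?_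
    obtain ⟨k, hk⟩ := (mem_repLieAlgebra_iff_real r).1 hYL t
    have hk1 : k = 1 := by simpa using hSbot ⟨t, hk⟩
    rw [smul_zero, exp_zero, ← hk, hk1, map_one]
  · -- Step 4: `K° = ⊤` — `J` is central in `𝔥`, hence zero, so `I = 𝔥`
    right
    have hKtop : ∀ g : G, g ∈ K := fun g => hK₀le (show g ∈ K₀ by rw [htop]; trivial)
    have hJcomm : ∀ X ∈ repLieAlgebra r, ∀ Z ∈ J, X * Z = Z * X := by
      intro X hX Z hZ
      refine mul_comm_of_forall_exp_smul fun t => ?_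
      obtain ⟨k, hk⟩ := (mem_repLieAlgebra_iff_real r).1 hX t
      rw [← hk]
      exact hKtop k Z hZ
    have hJzero : ∀ Z ∈ J, Z = 0 := by
      intro Z hZ
      have hZc : Z ∈ r.lieAlgCarrier := by
        rw [lieAlgCarrier_eq_coe]
        exact hJL hZ
      refine eq_zero_of_commute_lieAlg hG.1 r hZc fun X hX => ?_
      rw [lieAlgCarrier_eq_coe] at hX
      exact (hJcomm X hX Z hZ).symm
    refine le_antisymm hIL fun X hX => ?_
    obtain ⟨Y, hY, hXY⟩ := hsplit X hX
    rw [sub_eq_zero.1 (hJzero _ hXY)]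
    exact hY

end Summit.QuantumFields.YangMills.Theorems.BrascampLiebVacuumSC

end
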